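import Mathlib
import Summits.NavierStokesRegularity.NavierStokesRegularity.Theorems.FilamentSkeletonRssDefectColumnGateQuadrupoleBlockPrelim

/-!
# Route `FilamentSkeletonRss` · crux `TransverseReduction1AG` (stmt-NavierStokesRegularity-27853) · line `defect_column_gate_1AG` —
# the m = 2 (quadrupole) radial block of S2a-loc `WaistColumnGateLoc1A`: FLUX IDENTITIES and the bound of the inner flux `H`

Helper file (`--supports stmt-NavierStokesRegularity-27853 --as helper`; seat ns-filament-s2aloc-p1 g0; briefs v5 brick B2, m = 2 instance, symmetric
column, `Rc = 0`).  Second of three files (`…QuadrupoleBlockPrelim` ⟵ this ⟵ `…QuadrupoleBlock`).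

SETTING (u = r², the m = 2 vorticity coefficient is `w = u·v`): data `v, v₁ = v′` on `(0,∞)` and the block `Φ′ = 4v − f` with
`Φ = 4u v + 4u² v₁ + γu² v` (`f = L₂ w = −(4uw′ + γuw)′ + 4w/u`).  Auxiliary functions (all written out, no definitions):
`E = e^{γu/4}`, `g = (16/γ²)(1 − e^{−γu/4}(1+γu/4))` (Prelim), `K = 4E·(2v + u v₁)`, `H = 4u² v − g·K`.
CONTENTS: (1) a comparison lemma `|h(b) − h(a)| ≤ A(b) − A(a)` from `|h′| ≤ A′` (so that the datum `f` is never integrated);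
`g(s) ≤ 2(1+16/γ²)·s/(1+s)`; (2) the flux identities `K′ = −E f/u`, `H′ = g E f/u` on `(0,∞)` (`quadrupoleBlock_hasDerivAt_K/H`); (3) the bounds of
the inner flux from `u = 0`: `|H(u)| ≤ G₀ M u E(u)` for all `u ≥ 0` and `|H(u)| ≤ (4G₀M/γ)E(s₁) + (16G₀M/γ)E(u)/(1+u)²` for `u ≥ s₁ = 1 + 16/γ`,
`G₀ = 2(1 + 16/γ²)` (`quadrupoleBlock_H_bounds`), by comparison with `(4G₀M/γ)E` on `[0,u]` and `(16G₀M/γ)E/(1+u)²` on `[s₁,u]`.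
HONEST FRAMING: one block of one linear MODEL operator of a hypothetical blow-up route (MODEL rung, negative side); nothing here bears on
Navier–Stokes regularity.
-/

set_option linter.dupNamespace false

noncomputable section

namespace Summit.NavierStokesRegularity.NavierStokesRegularity.Theorems.DefectColumnGate

open scoped Topology
open Set Filter MeasureTheory intervalIntegral

/-! ## 1. Tools -/

/-- If `|h′| ≤ A′` on `(a,b)` and `h, A` are continuous on `[a,b]`, then `|h b − h a| ≤ A b − A a`. -/
theorem abs_sub_le_of_deriv_abs_le {a b : ℝ} (hab : a ≤ b) {h A h' A' : ℝ → ℝ}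
    (hh : ContinuousOn h (Icc a b)) (hA : ContinuousOn A (Icc a b))
    (hhd : ∀ x ∈ Ioo a b, HasDerivAt h (h' x) x) (hAd : ∀ x ∈ Ioo a b, HasDerivAt A (A' x) x)
    (hle : ∀ x ∈ Ioo a b, |h' x| ≤ A' x) :
    |h b - h a| ≤ A b - A a := by
  have hint : interior (Icc a b) = Ioo a b := interior_Icc
  have hmono₁ : MonotoneOn (fun x => A x - h x) (Icc a b) := by
    apply monotoneOn_of_hasDerivWithinAt_nonneg (f' := fun x => A' x - h' x) (convex_Icc a b) (hA.sub hh)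
    · intro x hx; rw [hint] at hx
      exact ((hAd x hx).sub (hhd x hx)).hasDerivWithinAt
    · intro x hx; rw [hint] at hx
      have := hle x hx
      have := neg_abs_le (h' x)
      linarith [le_abs_self (h' x)]
  have hmono₂ : MonotoneOn (fun x => A x + h x) (Icc a b) := by
    apply monotoneOn_of_hasDerivWithinAt_nonneg (f' := fun x => A' x + h' x) (convex_Icc a b) (hA.add hh)
    · intro x hx; rw [hint] at hx
      exact ((hAd x hx).add (hhd x hx)).hasDerivWithinAt
    · intro x hx; rw [hint] at hx
      have := hle x hx
      linarith [neg_abs_le (h' x)]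
  have ha : a ∈ Icc a b := left_mem_Icc.mpr hab
  have hb : b ∈ Icc a b := right_mem_Icc.mpr hab
  have h₁ := hmono₁ ha hb hab
  have h₂ := hmono₂ ha hb hab
  simp only at h₁ h₂
  rw [abs_le]; constructor <;> linarith

/-- The closed-form m = 2 profile is at most linear-over-linear: `g(s) ≤ 2(1 + 16/γ²)·s/(1+s)` for `s ≥ 0`
(from `g ≤ s²` on `[0,1]` and `g ≤ 16/γ²` on `[1,∞)`). -/
theorem quadG_le_lin {γ : ℝ} (hγ : 0 < γ) {s : ℝ} (hs : 0 ≤ s) :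
    16 / γ ^ 2 * (1 - Real.exp (-(γ * s / 4)) * (1 + γ * s / 4)) ≤ 2 * (1 + 16 / γ ^ 2) * s / (1 + s) := by
  have h1s : 0 < 1 + s := by linarith
  have h16 : (0:ℝ) ≤ 16 / γ ^ 2 := by positivity
  rw [le_div_iff₀ h1s]
  rcases le_total s 1 with hle | hge
  · have hsq := quadG_le_sq hγ hs
    have h2 : (1 + s) ≤ 2 := by linarith
    have h3 : s ^ 2 * (1 + s) ≤ s ^ 2 * 2 := mul_le_mul_of_nonneg_left h2 (sq_nonneg s)
    have h4 : s ^ 2 * 2 ≤ 2 * (1 + 16 / γ ^ 2) * s := by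
      have : s ^ 2 ≤ s := by nlinarith
      nlinarith
    calc 16 / γ ^ 2 * (1 - Real.exp (-(γ * s / 4)) * (1 + γ * s / 4)) * (1 + s) ≤ s ^ 2 * (1 + s) :=
          mul_le_mul_of_nonneg_right hsq h1s.le
      _ ≤ 2 * (1 + 16 / γ ^ 2) * s := h3.trans h4
  · have hsup := quadG_le_sup hγ hs
    have h2 : 16 / γ ^ 2 * (1 + s) ≤ 2 * (1 + 16 / γ ^ 2) * s := by
      have : (1 + s) ≤ 2 * s := by linarith
      calc 16 / γ ^ 2 * (1 + s) ≤ 16 / γ ^ 2 * (2 * s) := mul_le_mul_of_nonneg_left this h16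
        _ ≤ 2 * (1 + 16 / γ ^ 2) * s := by nlinarith
    calc 16 / γ ^ 2 * (1 - Real.exp (-(γ * s / 4)) * (1 + γ * s / 4)) * (1 + s) ≤ 16 / γ ^ 2 * (1 + s) :=
          mul_le_mul_of_nonneg_right hsup h1s.le
      _ ≤ 2 * (1 + 16 / γ ^ 2) * s := h2

/-! ## 2. The flux identities `K′ = −E f/u`, `H′ = g E f/u` on `(0,∞)` -/

/-- `K := 4e^{γu/4}(2v + u v₁)` has `K′ = −e^{γu/4} f/u` on `(0,∞)` when `v′ = v₁` and `(4u v + 4u² v₁ + γu² v)′ = 4v − f`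
(indeed `K = e^{γu/4}(Φ + 4uv − γu²v)/u`). -/
theorem quadrupoleBlock_hasDerivAt_K {γ : ℝ} {v v₁ f : ℝ → ℝ}
    (hder : ∀ u, 0 < u → HasDerivAt v (v₁ u) u)
    (hΦ : ∀ u, 0 < u → HasDerivAt (fun s => 4 * s * v s + 4 * s ^ 2 * v₁ s + γ * s ^ 2 * v s) (4 * v u - f u) u)
    {s : ℝ} (hs : 0 < s) :
    HasDerivAt (fun t => 4 * Real.exp (γ * t / 4) * (2 * v t + t * v₁ t)) (-(Real.exp (γ * s / 4) * f s / s)) s := by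
  set E : ℝ → ℝ := fun t => Real.exp (γ * t / 4) with hEdef
  set Φf : ℝ → ℝ := fun t => 4 * t * v t + 4 * t ^ 2 * v₁ t + γ * t ^ 2 * v t with hΦdef
  have hE : HasDerivAt E (E s * (γ * 1 / 4)) s := (((hasDerivAt_id' s).const_mul γ).div_const 4).exp
  have hKΦ : ∀ t, t ≠ 0 → 4 * E t * (2 * v t + t * v₁ t) = E t * (Φf t + 4 * t * v t - γ * t ^ 2 * v t) / t := by
    intro t ht
    simp only [hΦdef]
    field_simp
    ring
  have hA : HasDerivAt (fun t => 4 * t * v t - γ * t ^ 2 * v t)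
      (4 * 1 * v s + 4 * s * v₁ s - (γ * ((2:ℕ) * s ^ (2 - 1) * 1) * v s + γ * s ^ 2 * v₁ s)) s := by
    have h1 : HasDerivAt (fun t => 4 * t * v t) (4 * 1 * v s + 4 * s * v₁ s) s :=
      ((hasDerivAt_id' s).const_mul 4).mul (hder s hs)
    have h2 : HasDerivAt (fun t => γ * t ^ 2 * v t) (γ * ((2:ℕ) * s ^ (2 - 1) * 1) * v s + γ * s ^ 2 * v₁ s) s :=
      (((hasDerivAt_id' s).pow 2).const_mul γ).mul (hder s hs)
    exact h1.sub h2
  have hnum : HasDerivAt (fun t => Φf t + (4 * t * v t - γ * t ^ 2 * v t))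
      ((4 * v s - f s) + (4 * 1 * v s + 4 * s * v₁ s - (γ * ((2:ℕ) * s ^ (2 - 1) * 1) * v s + γ * s ^ 2 * v₁ s))) s :=
    (hΦ s hs).add hA
  have hquot := hE.mul (hnum.div (hasDerivAt_id' s) hs.ne')
  have hKΦ' : (fun t => 4 * Real.exp (γ * t / 4) * (2 * v t + t * v₁ t))
      =ᶠ[𝓝 s] fun t => E t * ((Φf t + (4 * t * v t - γ * t ^ 2 * v t)) / t) := by
    filter_upwards [eventually_ne_nhds hs.ne'] with t ht
    rw [hKΦ t ht]
    ring
  refine (hquot.congr_of_eventuallyEq hKΦ').congr_deriv ?_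
  have hs0 : s ≠ 0 := hs.ne'
  simp only [hΦdef, Pi.div_apply, Nat.cast_ofNat]
  field_simp
  ring

/-- `H := 4u²v − g·K` has `H′ = g e^{γu/4} f/u` on `(0,∞)` (`g′ = u e^{−γu/4}` kills the `(4u²v)′ = 4u(2v + u v₁)` term exactly). -/
theorem quadrupoleBlock_hasDerivAt_H {γ : ℝ} (hγ : 0 < γ) {v v₁ f : ℝ → ℝ}
    (hder : ∀ u, 0 < u → HasDerivAt v (v₁ u) u)
    (hΦ : ∀ u, 0 < u → HasDerivAt (fun s => 4 * s * v s + 4 * s ^ 2 * v₁ s + γ * s ^ 2 * v s) (4 * v u - f u) u)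
    {s : ℝ} (hs : 0 < s) :
    HasDerivAt (fun t => 4 * t ^ 2 * v t
        - (16 / γ ^ 2 * (1 - Real.exp (-(γ * t / 4)) * (1 + γ * t / 4))) * (4 * Real.exp (γ * t / 4) * (2 * v t + t * v₁ t)))
      ((16 / γ ^ 2 * (1 - Real.exp (-(γ * s / 4)) * (1 + γ * s / 4))) * Real.exp (γ * s / 4) * f s / s) s := by
  set g : ℝ → ℝ := fun t => 16 / γ ^ 2 * (1 - Real.exp (-(γ * t / 4)) * (1 + γ * t / 4)) with hgdef
  set K : ℝ → ℝ := fun t => 4 * Real.exp (γ * t / 4) * (2 * v t + t * v₁ t) with hKdef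
  have hK : HasDerivAt K (-(Real.exp (γ * s / 4) * f s / s)) s := quadrupoleBlock_hasDerivAt_K hder hΦ hs
  have hg' : HasDerivAt g (s * Real.exp (-(γ * s / 4))) s := quadG_hasDerivAt hγ.ne' s
  have h1 : HasDerivAt (fun t => 4 * t ^ 2 * v t) (4 * ((2:ℕ) * s ^ (2 - 1) * 1) * v s + 4 * s ^ 2 * v₁ s) s :=
    (((hasDerivAt_id' s).pow 2).const_mul 4).mul (hder s hs)
  have h2 : HasDerivAt (fun t => g t * K t) (s * Real.exp (-(γ * s / 4)) * K s + g s * (-(Real.exp (γ * s / 4) * f s / s))) s :=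
    hg'.mul hK
  refine (h1.sub h2).congr_deriv ?_
  have hs0 : s ≠ 0 := hs.ne'
  have hEs : Real.exp (γ * s / 4) ≠ 0 := (Real.exp_pos _).ne'
  have hexpinv : Real.exp (-(γ * s / 4)) = (Real.exp (γ * s / 4))⁻¹ := Real.exp_neg _
  simp only [hKdef, hgdef, Nat.cast_ofNat]
  rw [hexpinv]
  field_simp
  ring

/-! ## 3. Bounds of the inner flux `H` from `u = 0` -/

set_option maxHeartbeats 800000 in
/-- **Bounds of `H = 4u²v − g·K`.**  Under the block hypotheses with datum `(1+u)²|f| ≤ M`: for all `u ≥ 0`,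
`|H(u)| ≤ G₀ M u e^{γu/4}`, and for `u ≥ s₁ := 1 + 16/γ`, `|H(u)| ≤ (4G₀M/γ)e^{γs₁/4} + (16G₀M/γ)e^{γu/4}/(1+u)²`, `G₀ = 2(1+16/γ²)`. -/
theorem quadrupoleBlock_H_bounds {γ : ℝ} (hγ : 0 < γ) {M : ℝ} {v v₁ f : ℝ → ℝ}
    (hv : ContinuousOn v (Ici 0)) (hv₁ : ContinuousOn v₁ (Ici 0))
    (hder : ∀ u, 0 < u → HasDerivAt v (v₁ u) u)
    (hΦ : ∀ u, 0 < u → HasDerivAt (fun s => 4 * s * v s + 4 * s ^ 2 * v₁ s + γ * s ^ 2 * v s) (4 * v u - f u) u)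
    (hf : ∀ u, 0 < u → (1 + u) ^ 2 * |f u| ≤ M) :
    (∀ u, 0 ≤ u → |4 * u ^ 2 * v u
        - (16 / γ ^ 2 * (1 - Real.exp (-(γ * u / 4)) * (1 + γ * u / 4))) * (4 * Real.exp (γ * u / 4) * (2 * v u + u * v₁ u))|
        ≤ 2 * (1 + 16 / γ ^ 2) * M * u * Real.exp (γ * u / 4)) ∧
    (∀ u, 1 + 16 / γ ≤ u → |4 * u ^ 2 * v u
        - (16 / γ ^ 2 * (1 - Real.exp (-(γ * u / 4)) * (1 + γ * u / 4))) * (4 * Real.exp (γ * u / 4) * (2 * v u + u * v₁ u))|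
        ≤ 4 * (2 * (1 + 16 / γ ^ 2)) * M / γ * Real.exp (γ * (1 + 16 / γ) / 4)
          + 16 * (2 * (1 + 16 / γ ^ 2)) * M / γ * (Real.exp (γ * u / 4) / (1 + u) ^ 2)) := by
  set G₀ : ℝ := 2 * (1 + 16 / γ ^ 2) with hG₀
  set s₁ : ℝ := 1 + 16 / γ with hs₁
  set g : ℝ → ℝ := fun t => 16 / γ ^ 2 * (1 - Real.exp (-(γ * t / 4)) * (1 + γ * t / 4)) with hgdef
  set E : ℝ → ℝ := fun t => Real.exp (γ * t / 4) with hEdef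
  set K : ℝ → ℝ := fun t => 4 * E t * (2 * v t + t * v₁ t) with hKdef
  set H : ℝ → ℝ := fun t => 4 * t ^ 2 * v t - g t * K t with hHdef
  show (∀ u, 0 ≤ u → |H u| ≤ G₀ * M * u * E u) ∧
    (∀ u, s₁ ≤ u → |H u| ≤ 4 * G₀ * M / γ * E s₁ + 16 * G₀ * M / γ * (E u / (1 + u) ^ 2))
  have hG₀pos : 0 < G₀ := by positivity
  have hs₁ge : 1 ≤ s₁ := le_add_of_nonneg_right (by positivity)
  have hM : 0 ≤ M := le_trans (by positivity) (hf 1 one_pos)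
  have hfle : ∀ s, 0 < s → |f s| ≤ M / (1 + s) ^ 2 := fun s hs => by
    rw [le_div_iff₀ (by positivity)]; linarith [hf s hs]
  have hEpos : ∀ s, 0 < E s := fun s => Real.exp_pos _
  have hE : ∀ s, HasDerivAt E (E s * (γ * 1 / 4)) s := fun s =>
    (((hasDerivAt_id' s).const_mul γ).div_const 4).exp
  have hH : ∀ s, 0 < s → HasDerivAt H (g s * E s * f s / s) s := fun s hs =>
    quadrupoleBlock_hasDerivAt_H hγ hder hΦ hs
  have hg_nonneg : ∀ s, 0 ≤ s → 0 ≤ g s := fun s hs => quadG_nonneg hγ hs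
  have hgs : ∀ s, 0 ≤ s → g s ≤ G₀ * s / (1 + s) := fun s hs => quadG_le_lin hγ hs
  have hg0 : g 0 = 0 := by simp [hgdef]
  have hH0 : H 0 = 0 := by simp [hHdef, hg0]
  have hE0 : E 0 = 1 := by simp [hEdef]
  have hEc : Continuous E := by simp only [hEdef]; fun_prop
  have hgc : Continuous g := by simp only [hgdef]; fun_prop
  have hKc : ContinuousOn K (Ici 0) := by
    simp only [hKdef]
    exact (continuousOn_const.mul hEc.continuousOn).mul
      ((continuousOn_const.mul hv).add (continuousOn_id.mul hv₁))
  have hHc : ContinuousOn H (Ici 0) := by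
    simp only [hHdef]
    exact ((continuousOn_const.mul (continuousOn_pow 2)).mul hv).sub (hgc.continuousOn.mul hKc)
  have hexp_sub_one : ∀ u, E u - 1 ≤ γ * u / 4 * E u := by
    -- `eᵗ − 1 ≤ t eᵗ` (from `1 − t ≤ e^{−t}`); also in the tree as `Literature…AreaLaw.exp_sub_one_le_mul_exp`, re-derived here in
    -- three lines to keep this block free of the lattice-gauge-theory import chain
    intro u
    have h := Real.add_one_le_exp (-(γ * u / 4))
    have hprod : Real.exp (-(γ * u / 4)) * E u = 1 := by simp only [hEdef]; rw [← Real.exp_add]; simp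
    have := mul_le_mul_of_nonneg_right h (hEpos u).le
    rw [hprod] at this
    nlinarith [this, hEpos u]
  clear_value g E K H
  -- |H'| ≤ G₀ M E/(1+s)³
  have hHder_bound : ∀ s, 0 < s → |g s * E s * f s / s| ≤ G₀ * M * E s / (1 + s) ^ 3 := by
    intro s hs
    have h1s : 0 < 1 + s := by linarith
    rw [abs_div, abs_mul, abs_mul, abs_of_nonneg (hg_nonneg s hs.le), abs_of_pos (hEpos s), abs_of_pos hs]
    have hG₀s : 0 ≤ G₀ * s / (1 + s) := by positivity
    have h1 : g s * E s ≤ (G₀ * s / (1 + s)) * E s := mul_le_mul_of_nonneg_right (hgs s hs.le) (hEpos s).le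
    have h2 : g s * E s * |f s| ≤ (G₀ * s / (1 + s)) * E s * (M / (1 + s) ^ 2) :=
      mul_le_mul h1 (hfle s hs) (abs_nonneg _) (mul_nonneg hG₀s (hEpos s).le)
    calc g s * E s * |f s| / s ≤ (G₀ * s / (1 + s)) * E s * (M / (1 + s) ^ 2) / s :=
          div_le_div_of_nonneg_right h2 hs.le
      _ = G₀ * M * E s / (1 + s) ^ 3 := by field_simp
  -- comparison on [0, u]
  have hA₁ : ∀ s, HasDerivAt (fun t => 4 * G₀ * M / γ * E t) (4 * G₀ * M / γ * (E s * (γ * 1 / 4))) s :=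
    fun s => (hE s).const_mul _
  have hHbound₁ : ∀ u, 0 ≤ u → |H u| ≤ 4 * G₀ * M / γ * (E u - 1) := by
    intro u hu
    have hcmp := abs_sub_le_of_deriv_abs_le (h := H) (A := fun t => 4 * G₀ * M / γ * E t) hu
      (hHc.mono Icc_subset_Ici_self) (continuousOn_const.mul hEc.continuousOn)
      (fun x hx => hH x hx.1) (fun x _ => hA₁ x)
      (fun x hx => by
        have hx0 : 0 < x := hx.1
        have h1x : (1:ℝ) ≤ (1 + x) ^ 3 := one_le_pow₀ (by linarith)
        calc |g x * E x * f x / x| ≤ G₀ * M * E x / (1 + x) ^ 3 := hHder_bound x hx0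
          _ ≤ G₀ * M * E x := div_le_self (mul_nonneg (mul_nonneg hG₀pos.le hM) (hEpos x).le) h1x
          _ = 4 * G₀ * M / γ * (E x * (γ * 1 / 4)) := by field_simp)
    rw [hH0, sub_zero, hE0] at hcmp
    calc |H u| ≤ 4 * G₀ * M / γ * E u - 4 * G₀ * M / γ * 1 := hcmp
      _ = 4 * G₀ * M / γ * (E u - 1) := by ring
  have hHbound₁' : ∀ u, 0 ≤ u → |H u| ≤ G₀ * M * u * E u := by
    intro u hu
    have h3 : 4 * G₀ * M / γ * (E u - 1) ≤ 4 * G₀ * M / γ * (γ * u / 4 * E u) :=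
      mul_le_mul_of_nonneg_left (hexp_sub_one u) (by positivity)
    calc |H u| ≤ 4 * G₀ * M / γ * (γ * u / 4 * E u) := (hHbound₁ u hu).trans h3
      _ = G₀ * M * u * E u := by field_simp
  -- comparison on [s₁, u]
  have hA₂ : ∀ s, 0 < s → HasDerivAt (fun t => 16 * G₀ * M / γ * (E t / (1 + t) ^ 2))
      (16 * G₀ * M / γ * ((E s * (γ * 1 / 4) * (1 + s) ^ 2 - E s * (↑(2:ℕ) * (1 + s) ^ (2 - 1) * 1)) / ((1 + s) ^ 2) ^ 2)) s := by
    intro s hs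
    have h1s : (1 + s) ^ 2 ≠ 0 := by positivity
    exact ((hE s).div (((hasDerivAt_id' s).const_add 1).pow 2) h1s).const_mul _
  have hHbound₂ : ∀ u, s₁ ≤ u → |H u| ≤ 4 * G₀ * M / γ * E s₁ + 16 * G₀ * M / γ * (E u / (1 + u) ^ 2) := by
    intro u hu
    have hs₁pos : 0 < s₁ := zero_lt_one.trans_le hs₁ge
    have hcmp := abs_sub_le_of_deriv_abs_le (h := H) (A := fun t => 16 * G₀ * M / γ * (E t / (1 + t) ^ 2)) hu
      (hHc.mono (fun x hx => (hs₁pos.le.trans hx.1 : 0 ≤ x)))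
      (by
        apply ContinuousOn.mul continuousOn_const
        apply ContinuousOn.div hEc.continuousOn (by fun_prop)
        intro x hx; have : 0 < x := hs₁pos.trans_le hx.1; positivity)
      (fun x hx => hH x (hs₁pos.trans hx.1)) (fun x hx => hA₂ x (hs₁pos.trans hx.1))
      (fun x hx => by
        have hx0 : 0 < x := hs₁pos.trans hx.1
        have h1x : 0 < 1 + x := by linarith
        have hkey : G₀ * M * E x / (1 + x) ^ 3
            ≤ 16 * G₀ * M / γ * ((E x * (γ * 1 / 4) * (1 + x) ^ 2 - E x * (↑(2:ℕ) * (1 + x) ^ (2 - 1) * 1)) / ((1 + x) ^ 2) ^ 2) := by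
          have hre : 16 * G₀ * M / γ * ((E x * (γ * 1 / 4) * (1 + x) ^ 2 - E x * (↑(2:ℕ) * (1 + x) ^ (2 - 1) * 1)) / ((1 + x) ^ 2) ^ 2)
              = (G₀ * M * (4 * (1 + x) - 32 / γ)) * (E x / (1 + x) ^ 3) := by
            simp only [Nat.cast_ofNat]
            field_simp
            ring
          rw [hre, show G₀ * M * E x / (1 + x) ^ 3 = (G₀ * M) * (E x / (1 + x) ^ 3) by ring]
          apply mul_le_mul_of_nonneg_right _ (div_nonneg (hEpos x).le (by positivity))
          apply le_mul_of_one_le_right (by positivity)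
          have hx1 : s₁ ≤ x := hx.1.le
          have h16 : 16 / γ = s₁ - 1 := by rw [hs₁]; ring
          rw [show 32 / γ = 2 * (16 / γ) by ring, h16]
          linarith only [hx1, hs₁ge]
        exact (hHder_bound x hx0).trans hkey)
    have hA₂nonneg : 0 ≤ 16 * G₀ * M / γ * (E s₁ / (1 + s₁) ^ 2) := by
      have := hEpos s₁; positivity
    have hHs₁ : |H s₁| ≤ 4 * G₀ * M / γ * E s₁ := by
      have h' : 4 * G₀ * M / γ * (E s₁ - 1) ≤ 4 * G₀ * M / γ * E s₁ :=
        mul_le_mul_of_nonneg_left (by linarith) (by positivity)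
      exact (hHbound₁ s₁ hs₁pos.le).trans h'
    have htri : |H u| ≤ |H s₁| + |H u - H s₁| := by
      have := abs_add_le (H s₁) (H u - H s₁)
      rwa [add_sub_cancel] at this
    linarith only [htri, hcmp, hHs₁, hA₂nonneg]
  exact ⟨hHbound₁', hHbound₂⟩

end Summit.NavierStokesRegularity.NavierStokesRegularity.Theorems.DefectColumnGate

end
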